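import Summits.BirchSwinnertonDyer.Rank1Residual.X2.ResidualDevissageModules
import Literature.NumberTheory.EllipticCurves.KellerYin2024.AnomalousLambdaInvariants
import Literature.NumberTheory.EllipticCurves.KellerYin2024.CharacterModulePrufer
import Literature.NumberTheory.EllipticCurves.DivisionFieldRamificationDividesProofs
import HarnessLib

/-!
# The residual pair `(ω̃, 𝟙̃)` of `E_K[p]` as a STABLE LINE with equivariant embeddings
# `Φ ↪ (F/𝒪)(ω̃)`, `E_K[p]/Φ ↪ (F/𝒪)(𝟙̃)` onto the `p`-torsion
# (cell `bsd-eis`, seat `bsd-line-x1-p1` LEAD g3, D-0154 KEY row 4; crux 2 `GoodLatticeBDPValue`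
# stmt-BirchSwinnertonDyer-19032, line `halves` v17, stub `stub_imprim` = Keller–Yin Thm. 1.4.1)

HONEST FRAMING (cell `bsd-eis`, run/shared/lean/pub/bsd-eis/): plumbing between two typed currencies
(`KellerYin2024.IsResidualPairOver` — the residual pair of the line's statements — and the
`StableSubgroup` dévissage currency of `Theorems/EisensteinPrimesResidualDevissageFiniteKernel.lean`); no
definition, no named fact, no `sorry`, no `Theses` import; nothing about BSD / IMC2 / KY Thm. 1.4.1 is
proved. Helper `--supports stmt-BirchSwinnertonDyer-19032`.

## What
`IsResidualPairOver E_K p θsub θquot` says: there is a `Γ_K`-stable subgroup `Φ ≤ E_K[p]` of order `p`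
on which `Γ_K` acts by an integer `a ≡ θsub(σ) (mod 𝔭)` and on `E_K[p]/Φ` by an integer
`a ≡ θquot(σ) (mod 𝔭)` (Teichmüller lifts, KY §1.4 display (char to f)). This file turns that into the
input shape of the dévissage and of `CharResidualSelmerFinite.finite_residualStrictSelmer_of_forall_dualData`:
* §1 `unitChar_sub_intCast_mem_span` — `‖θ(σ)₀₀ − a‖ < 1` in `ℚ̄_p` iff `unitChar θ σ − a ∈ pℤ_p`.
* §2 `exists_embedding_charModule_of_card_eq` — ANY `Γ_K`-module `C` of order `p` on which every `σ` acts
  by an integer `≡ unitChar θ σ (mod p)` embeds equivariantly into `(F/𝒪)(θ) ≅ ℚ_p/ℤ_p(θ)` with image the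
  `p`-torsion (a generator goes to `t₁ = 1/p`; `QpModZp.zmodToSocle`).
* §3 `exists_stableLine_of_isResidualPairOver` — the `StableSubgroup Γ_K E_K[p]` cut out by `Φ`, with
  `#Φ = #(E_K[p]/Φ) = p` and the two embeddings.

References: [KellerYin2024] §1.1 (TeX L441–449), §1.4 display (char to f) (arXiv:2402.12781v2 TeX
L1063–1086); [CastellaGrossiLeeSkinner2022] §1.4 (the line `𝔽(φ) ⊂ E[p]`); [GreenbergVatsal2000] §2 p. 28;
[SilvermanAEC2009] Cor. III.6.4 (b).
-/

set_option autoImplicit false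
set_option linter.dupNamespace false -- the summit namespace `…BirchSwinnertonDyer.BirchSwinnertonDyer.Theorems` (Sub = Summit, D-0017) trips it

noncomputable section

open scoped Classical

namespace Summit.BirchSwinnertonDyer.BirchSwinnertonDyer.Theorems.ResidualPairStableLine

open NumberField IsDedekindDomain Field WeierstrassCurve
open Literature.NumberTheory.EllipticCurves Literature.NumberTheory.EllipticCurves.GreenbergSelmer
  Literature.NumberTheory.GaloisRepresentations Literature.NumberTheory.EllipticCurves.KellerYin2024
  Literature.NumberTheory.IwasawaTheory
  Summit.BirchSwinnertonDyer.Rank1Residual.X2.ResidualDevissageModules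

/-! ### §1 `‖θ(σ) − a‖ < 1` in `ℚ̄_p` versus `unitChar θ σ − a ∈ pℤ_p` -/

section Bridge

variable {K : Type} [Field K] {p : ℕ} [hp : Fact p.Prime]
  (θ : FramedGaloisRep K (padicCoeffIntegers (∅ : Set (PadicAlgCl p))) 1)

/-- The matrix entry `θ(σ)₀₀ ∈ 𝓞` is the image of `unitChar θ σ ∈ ℤ_p` under `ℤ_p ≅ 𝓞`
(`padicIntEquiv_unitChar`). [cite: KellerYin2024, §1.1 (arXiv:2402.12781v2 TeX L441–449)] -/
theorem entry_eq_padicIntEquiv_unitChar (σ : absoluteGaloisGroup K) :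
    entry (∅ : Set (PadicAlgCl p)) θ σ =
      padicIntEquivCoeffIntegersEmpty p ((unitChar θ σ : ℤ_[p]ˣ) : ℤ_[p]) := by
  rw [padicIntEquiv_unitChar]
  rfl

/-- **`‖θ(σ)₀₀ − a‖ < 1` in `ℚ̄_p` ⟹ `unitChar θ σ − a ∈ pℤ_p`** (the Teichmüller congruence of
`IsTeichmullerLiftOn(Quot)` read in `ℤ_p`). [cite: KellerYin2024, §1.1 and §1.4 (arXiv:2402.12781v2 TeX L441, L1063–1086)] -/
theorem unitChar_sub_intCast_mem_span (σ : absoluteGaloisGroup K) {a : ℤ}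
    (h : ‖((entry (∅ : Set (PadicAlgCl p)) θ σ : padicCoeffIntegers (∅ : Set (PadicAlgCl p))) :
      PadicAlgCl p) - (a : PadicAlgCl p)‖ < 1) :
    ((unitChar θ σ : ℤ_[p]ˣ) : ℤ_[p]) - (a : ℤ_[p]) ∈ Ideal.span {(p : ℤ_[p]) ^ 1} := by
  set u : ℤ_[p] := ((unitChar θ σ : ℤ_[p]ˣ) : ℤ_[p]) with hu
  have he : ((entry (∅ : Set (PadicAlgCl p)) θ σ : padicCoeffIntegers (∅ : Set (PadicAlgCl p))) :
      PadicAlgCl p) - (a : PadicAlgCl p) =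
        algebraMap ℚ_[p] (PadicAlgCl p) (((u - (a : ℤ_[p]) : ℤ_[p]) : ℚ_[p])) := by
    rw [entry_eq_padicIntEquiv_unitChar, coe_padicIntEquivCoeffIntegersEmpty, PadicInt.coe_sub,
      map_sub, PadicInt.coe_intCast, map_intCast]
  rw [he, norm_algebraMap', PadicInt.padic_norm_e_of_padicInt] at h
  rw [pow_one, Ideal.mem_span_singleton]
  exact (PadicInt.norm_lt_one_iff_dvd _).mp h

end Bridge

/-! ### §2 A `Γ_K`-module of order `p` with scalar action `≡ θ` embeds in `(F/𝒪)(θ)` onto the `p`-torsion -/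

section Embedding

variable {K : Type} [Field K] {p : ℕ} [hp : Fact p.Prime]
  (θ : FramedGaloisRep K (padicCoeffIntegers (∅ : Set (PadicAlgCl p))) 1)
  {C : Type} [AddCommGroup C] [DistribMulAction (absoluteGaloisGroup K) C]

/-- **Equivariant embedding `C ↪ (F/𝒪)(θ)` onto the `p`-torsion**, for ANY `Γ_K`-module `C` of order
`p` on which each `σ` acts by an integer `a` with `unitChar θ σ ≡ a (mod p)`: `C` is cyclic, a
generator goes to `t₁ = 1/p ∈ ℚ_p/ℤ_p ≅ (F/𝒪)(θ)` (`zmodToSocle ∘ (ZMod p ≃ C)⁻¹`, `charModuleEquiv⁻¹`);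
equivariance because `θ(σ)` and `a` act alike on `p`-torsion (`smul_eq_of_sub_mem_of_nsmul_eq_zero`);
image = socle (`exists_eq_nsmul_tgen_one`). [cite: KellerYin2024, §1.1 (arXiv:2402.12781v2 TeX L441–449), §1.4 (L1063–1086)]
[cite: Hungerford1974, Ch. I §3 Exercise 7 (d)] -/
theorem exists_embedding_charModule_of_card_eq (hC : Nat.card C = p)
    (hact : ∀ σ : absoluteGaloisGroup K, ∃ a : ℤ,
      ((unitChar θ σ : ℤ_[p]ˣ) : ℤ_[p]) - (a : ℤ_[p]) ∈ Ideal.span {(p : ℤ_[p]) ^ 1} ∧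
        ∀ c : C, σ • c = a • c) :
    ∃ j : C →+ charModule (∅ : Set (PadicAlgCl p)) θ,
      (∀ (σ : absoluteGaloisGroup K) (c : C), j (σ • c) = σ • j c) ∧ Function.Injective j ∧
        ∀ x : charModule (∅ : Set (PadicAlgCl p)) θ, x ∈ j.range ↔ p • x = 0 := by
  -- `C` is cyclic of order `p`
  haveI hcyc : IsAddCyclic C := isAddCyclic_of_prime_card hC
  obtain ⟨g, hg⟩ := IsAddCyclic.exists_generator (α := C)
  let e₁ : ZMod p ≃+ C := zmodAddEquivOfGenerator hg hC
  let j : C →+ charModule (∅ : Set (PadicAlgCl p)) θ :=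
    (charModuleEquiv θ).symm.toAddMonoidHom.comp ((QpModZp.zmodToSocle p).comp e₁.symm.toAddMonoidHom)
  have hj : ∀ c : C, j c = (charModuleEquiv θ).symm (QpModZp.zmodToSocle p (e₁.symm c)) :=
    fun _ ↦ rfl
  -- `pC = 0`, so `j(C)` is `p`-torsion
  have hpC : ∀ c : C, p • c = 0 := fun c ↦ by rw [← hC]; exact card_nsmul_eq_zero'
  have hpz : ∀ k : ZMod p, p • QpModZp.zmodToSocle p k = 0 := fun k ↦ by
    rw [← map_nsmul, nsmul_eq_mul, ZMod.natCast_self, zero_mul, map_zero]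
  have hpj : ∀ c : C, p • j c = 0 := fun c ↦ by rw [← map_nsmul, hpC, map_zero]
  refine ⟨j, fun σ c ↦ ?_, ?_, fun x ↦ ⟨?_, fun hx ↦ ?_⟩⟩
  · -- equivariance: `θ(σ)` and `a` act alike on the socle
    obtain ⟨a, ha, hσ⟩ := hact σ
    have h1 : p ^ 1 • QpModZp.zmodToSocle p (e₁.symm c) = 0 := by rw [pow_one]; exact hpz _
    rw [hσ, map_zsmul, hj]
    apply (charModuleEquiv θ).injective
    rw [map_zsmul, AddEquiv.apply_symm_apply, charModuleEquiv_galois_smul, AddEquiv.apply_symm_apply,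
      QpModZp.smul_eq_of_sub_mem_of_nsmul_eq_zero h1 ha, Int.cast_smul_eq_zsmul]
  · -- injectivity
    exact (charModuleEquiv θ).symm.injective.comp
      (QpModZp.injective_zmodToSocle.comp e₁.symm.injective)
  · -- the image is `p`-torsion
    rintro ⟨c, rfl⟩
    exact hpj c
  · -- the `p`-torsion is in the image
    have hx' : p • charModuleEquiv θ x = 0 := by rw [← map_nsmul, hx, map_zero]
    obtain ⟨m, hm⟩ := QpModZp.exists_eq_nsmul_tgen_one hx'
    refine ⟨e₁ ((m : ℤ) : ZMod p), ?_⟩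
    rw [hj, AddEquiv.symm_apply_apply, QpModZp.zmodToSocle_intCast, natCast_zsmul, ← hm,
      AddEquiv.symm_apply_apply]

end Embedding

/-! ### §3 The stable line of a residual pair, with both embeddings -/

section Line

variable {K : Type} [Field K] [NumberField K] (WK : WeierstrassCurve K) [WK.IsElliptic]
  {p : ℕ} [hp : Fact p.Prime]

/-- **The residual pair as a stable line with embeddings.** For `IsResidualPairOver E_K p θsub θquot`
there is a `Γ_K`-stable subgroup `Φ ≤ E_K[p]` (a `StableSubgroup`, the dévissage currency) with
`#Φ = #(E_K[p]/Φ) = p`, an equivariant embedding `Φ ↪ (F/𝒪)(θsub)` onto the `p`-torsion and an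
equivariant embedding `E_K[p]/Φ ↪ (F/𝒪)(θquot)` onto the `p`-torsion (`Φ ≅ 𝔽(ω̃)`, `E_K[p]/Φ ≅ 𝔽(𝟙̃)`).
[cite: KellerYin2024, §1.4 display (char to f) (arXiv:2402.12781v2 TeX L1063–1086)]
[cite: CastellaGrossiLeeSkinner2022, §1.4 (0 → 𝔽(φ) → E[p] → 𝔽(ψ) → 0)] [cite: SilvermanAEC2009, Cor. III.6.4(b)] -/
theorem exists_stableLine_of_isResidualPairOver
    {θsub θquot : FramedGaloisRep K (padicCoeffIntegers (∅ : Set (PadicAlgCl p))) 1}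
    (hpair : IsResidualPairOver WK p θsub θquot) :
    ∃ Φ : StableSubgroup (absoluteGaloisGroup K) (WK.geomTorsion (p : ℤ)),
      Nat.card Φ.Sub = p ∧ Nat.card Φ.Quot = p ∧
      (∃ j : Φ.Sub →+ charModule (∅ : Set (PadicAlgCl p)) θsub,
        (∀ (σ : absoluteGaloisGroup K) (y : Φ.Sub), j (σ • y) = σ • j y) ∧ Function.Injective j ∧
          ∀ x : charModule (∅ : Set (PadicAlgCl p)) θsub, x ∈ j.range ↔ p • x = 0) ∧
      (∃ j : Φ.Quot →+ charModule (∅ : Set (PadicAlgCl p)) θquot,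
        (∀ (σ : absoluteGaloisGroup K) (y : Φ.Quot), j (σ • y) = σ • j y) ∧ Function.Injective j ∧
          ∀ x : charModule (∅ : Set (PadicAlgCl p)) θquot, x ∈ j.range ↔ p • x = 0) := by
  obtain ⟨Φ, hcard, hle, hstab, hsub, hquot⟩ := hpair
  have hpp : p.Prime := hp.out
  -- the stable line in the dévissage currency
  let T : AddSubgroup (geomPoints WK) := WK.geomTorsion (p : ℤ)
  let L : StableSubgroup (absoluteGaloisGroup K) (WK.geomTorsion (p : ℤ)) :=
    { toAddSubgroup := Φ.addSubgroupOf T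
      smul_mem' := fun g {m} hm ↦ by
        change ((g • m : WK.geomTorsion (p : ℤ)) : geomPoints WK) ∈ Φ
        rw [AddSubgroup.torsionBy.coe_smul]
        exact hstab g _ hm }
  have hmemL : ∀ m : WK.geomTorsion (p : ℤ), m ∈ L.toAddSubgroup ↔ (m : geomPoints WK) ∈ Φ :=
    fun _ ↦ Iff.rfl
  -- cardinalities
  have hSub : Nat.card L.Sub = p :=
    (Nat.card_congr (AddSubgroup.addSubgroupOfEquivOfLe hle).toEquiv).trans hcard
  have hT : Nat.card (WK.geomTorsion (p : ℤ)) = p ^ 2 := WK.natCard_geomTorsion_prime_eq_sq hpp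
  have hQuot : Nat.card L.Quot = p := by
    have h := L.natCard_eq_mul
    rw [hT, hSub, sq] at h
    exact (Nat.eq_of_mul_eq_mul_right hpp.pos h).symm
  -- the scalar actions
  have hactSub : ∀ σ : absoluteGaloisGroup K, ∃ a : ℤ,
      ((unitChar θsub σ : ℤ_[p]ˣ) : ℤ_[p]) - (a : ℤ_[p]) ∈ Ideal.span {(p : ℤ_[p]) ^ 1} ∧
        ∀ c : L.Sub, σ • c = a • c := by
    intro σ
    obtain ⟨a, ha, hΦ⟩ := hsub.exists_smul_eq σ
    refine ⟨a, unitChar_sub_intCast_mem_span θsub σ ha, fun c ↦ L.incl_injective ?_⟩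
    rw [L.incl_smul, map_zsmul]
    apply Subtype.ext
    rw [AddSubgroup.torsionBy.coe_smul, AddSubgroupClass.coe_zsmul]
    exact hΦ _ ((hmemL _).mp c.2)
  have hactQuot : ∀ σ : absoluteGaloisGroup K, ∃ a : ℤ,
      ((unitChar θquot σ : ℤ_[p]ˣ) : ℤ_[p]) - (a : ℤ_[p]) ∈ Ideal.span {(p : ℤ_[p]) ^ 1} ∧
        ∀ c : L.Quot, σ • c = a • c := by
    intro σ
    obtain ⟨a, ha, hΦ⟩ := hquot.2 σ
    refine ⟨a, unitChar_sub_intCast_mem_span θquot σ ha, fun c ↦ ?_⟩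
    obtain ⟨m, rfl⟩ := L.proj_surjective c
    rw [L.smul_proj, ← map_zsmul, ← sub_eq_zero, ← map_sub, ← AddMonoidHom.mem_ker, L.ker_proj, hmemL,
      AddSubgroupClass.coe_sub, AddSubgroup.torsionBy.coe_smul, AddSubgroupClass.coe_zsmul]
    exact hΦ _ m.2
  exact ⟨L, hSub, hQuot, exists_embedding_charModule_of_card_eq θsub hSub hactSub,
    exists_embedding_charModule_of_card_eq θquot hQuot hactQuot⟩

end Line

end Summit.BirchSwinnertonDyer.BirchSwinnertonDyer.Theorems.ResidualPairStableLine

end
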